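/-
Copyright (c) 2026 the pub-hodgecm-mathlib formalisation cell (harness21).  Prover seat hodgecm-mathlib-K2E3-p31 (g0), HCML Track B «K2-LIT»,
h413 = `stmt-HodgeConjecture-24833`, line `K2_E3_EllipticInputs`, unit U12 «Characters», PART «SC» (ED. 2) leaf (SC-an)₂
`sig_K2E3SupercuspidalTruncatedCharAnalyticTwo`, road «FC₂» ∕ (M5h₂) chain — DOCKMASTER deal D161 (LINE-LEAD K2E3-plan (g4) 2026-09-04T15:17:02Z), DOCK B:
[M4]₂ LETTER-FREE — ★ p861272 `K2E3SupercuspidalTruncatedCharThm20Two` with its one letter `hT20` DISCHARGED by ★ K2E3-p32 (g0)'s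
`K2E3CuspFormCancellationU2LevelOne.cuspForm_cancellation_levelOne_U2` (Harish-Chandra's Theorem 20 on `K₁` for `U(σ, Φ₂)(K)`).  2026-09-04.
-/
import Summits.HodgeConjecture.HodgeConjecture.Theorems.K2E3SupercuspidalTruncatedCharThm20Two   -- ★ p861272 [M4]₂ (this seat), hypothesis-first over `hT20`; brings ★ p861231 (M5d)₂ any-rank, ★ p861233 [M1]₂
import Summits.HodgeConjecture.HodgeConjecture.Theorems.K2E3CuspFormCancellationU2LevelOne    -- ★ (K2E3-p32 g0) D137 FILE 3: THEOREM 20 for `U(σ, Φ₂)(K)` on the full level `K₁` — `cuspForm_cancellation_levelOne_U2`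
import HarnessLib

/-!
# K2_E3 road (h413), socket (SC-an)₂, [M4]₂ LETTER-FREE: THEOREM 20 PAYS THE TRUNCATED SUPERCUSPIDAL CHARACTER AT SPLIT-REGULAR ELEMENTS OF `U(σ, Φ₂)(K)` —
# `∫_{Ω n ∖ Ω R(g)} θ(x g x⁻¹) dx = 0`, `Θₙ(g) = ∫_{Ω n ∩ Ω R(g)}`, `Θₙ(g) → Θ_{R(g)}(g)`, NO hypothesis beyond the model frame (DOCK B of the (M5h₂) dockmaster)

Cell `pub/hodgecm-mathlib`, Track B «K2-LIT», crux H413 = `stmt-HodgeConjecture-24833` (`--supports … --as helper`, count-neutral); L4 LINE-LEAD K2E3-plan (g4) D161 («ONE hand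
owns every letter-free re-cut ∕ dock edition of this cone as letters turn ★»); consumers: K2E1-p10 (g3) D144 `K2E3SupercuspidalTruncatedCharLimCancTwo` (★ [M6] :115–:122's calls
with `3 ↦ 2`), the (M5h)₂ TOP payer K2E3-p23 (g7) ∕ desk K2E3-p27 (g0).  THEOREMS ONLY (no `def`, no `instance`, no `notation`, no named-fact hypothesis, no `sorry`); ★-only imports.

THE DOCK.  ★ p861272 `K2E3SupercuspidalTruncatedCharThm20Two` proves the two [M4] heads for `U(σ, Φ₂)(K)` over ONE letter `hT20` = Theorem 20 on `K₁ = U ∩ GL₂(𝒪)` ∀-closed over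
its Haar data `ν`, `ν̄`, the conjugator `y ∈ Ω_s`, the cusp form `f` with support datum `(C, m_C)` and its two cuspidality clauses.  ★ K2E3-p32 (g0)'s
`K2E3CuspFormCancellationU2LevelOne.cuspForm_cancellation_levelOne_U2 σ hσc hσv hJ μ ν ν̄ hϖ Ω hmem hinv hmul hy f hf C hC hsupp hcusp hcuspbar hx` IS that letter, binder for
binder (`(borelTriple σ J hJ).N ∕ .M` spellings, the ★ [M3] instance set `[SFinite] [IsOpenPosMeasure] [IsFiniteMeasureOnCompacts] [IsMulLeftInvariant]` on `ν`, `ν̄`, the radius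
`m_C + (1 + 2s + 4m_C) + s`, the level `(congruenceGL 2 1).comap U.subtype`).  Hence, with NO letter:
* **`setIntegral_sdiff_heightBall_coeff_conj_eq_zero`** — `∃ R, ∀ n, ∫ x in Ω n ∖ Ω R, B u' (ρ(x (y t y⁻¹) x⁻¹) u) dμ = 0`;
* **`exists_heightBall_truncatedCoeff_eq_inter_and_tendsto`** — `∃ R, (∀ n, Θₙ = ∫_{Ω n ∩ Ω R}) ∧ Θₙ → Θ_R`;
BINDERS = ★ [M4]'s with `3 ↦ 2` and ONLY `hσ` (`σ² = 1`), `h2` (`2 ≠ 0`) dropped (idle at `N = 2`: the rank-one line twist of ★ [M1]₂ needs neither) — i.e. K2E1-p10's slot-(1) call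
`…Thm20Two….setIntegral_sdiff_heightBall_coeff_conj_eq_zero σ hσσ hσc hσv two_ne_zero hJ μ hϖ …` minus its 2nd and 5th arguments, in THIS namespace
`…Cruxes.H413.K2E3SupercuspidalTruncatedCharThm20TwoOfLevelOne`.  After this file the [M4]₂ brick of the (M5h₂) chain carries NO named letter (★ [M1]₂ p861233, ★ [M3]₂ = ★ U2Torus ∕
InputsAnyRank ∕ U2Inputs ∕ U2LevelOne, ★ (M5d)₂ any-rank p861231, ★ (f1)).

HONEST LABEL: HC_CM is proved only modulo the 7 printed citations (2 remaining named inputs: hLiu418 = stmt-HodgeConjecture-24832, h413 =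
stmt-HodgeConjecture-24833) until rung 0 closes; this file is a count-neutral helper; (SC-an)₂ stays OPEN until COLL₂ + NC₂ + the whole (M5h₂) chain are ★.

## References
* [HarishChandra1970] Harish-Chandra (notes by G. van Dijk), *Harmonic Analysis on Reductive p-adic Groups*, LNM 162 (1970), Part VII §2 Theorem 20 p. 70;
  §3 p. 71 eq. (1), p. 72.
* [Rogawski1990] J. D. Rogawski, *Automorphic Representations of Unitary Groups in Three Variables*, Ann. of Math. Stud. 123 (1990), §1.10 p. 9, §4.9 p. 54.
* [Folland1995] G. B. Folland, *A Course in Abstract Harmonic Analysis* (1995), §2.4, §2.6.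
-/

set_option autoImplicit false
-- the mandated namespace repeats the single-problem summit's segment (`HodgeConjecture.HodgeConjecture`)
set_option linter.dupNamespace false

noncomputable section

open MeasureTheory Measure Set Filter Topology
open scoped NNReal ENNReal Pointwise Matrix MatrixGroups WithZero
open ValuativeRel
open Literature.NumberTheory.Automorphic Literature.NumberTheory.Automorphic.UnitaryGroup Literature.NumberTheory.Rogawski1990

namespace Summit.HodgeConjecture.HodgeConjecture.Cruxes.H413.K2E3SupercuspidalTruncatedCharThm20TwoOfLevelOne

variable {K : Type*} [Field K] [Valued K ℤᵐ⁰] [ValuativeRel K] [(Valued.v : Valuation K ℤᵐ⁰).Compatible] [IsNonarchimedeanLocalField K]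

set_option synthInstance.maxHeartbeats 400000 in
set_option maxHeartbeats 1600000 in
-- instance-term unification on the model carriers (same class and value as the ★ `Fin 3` template)
/-- **THE SHELL VANISHING `∫_{Ω n ∖ Ω R} θ(x g x⁻¹) dx = 0` FOR `g = y t y⁻¹` SPLIT-REGULAR, LETTER-FREE** (`t = diag d` regular, any `y`; `θ = B u' (ρ(·) u)` a coefficient of a
smooth supercuspidal `ρ` of `U(σ, Φ₂)(K)`, `μ` a left- and right-invariant Haar measure, `Ω` the height-ball exhaustion): ONE radius `R` serves every `n`.  ★ p861272 (hypothesis-first)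
with `hT20 :=` ★ `K2E3CuspFormCancellationU2LevelOne.cuspForm_cancellation_levelOne_U2` (Theorem 20 on `K₁`).  The `Fin 2` twin of ★ [M4] `setIntegral_sdiff_heightBall_coeff_conj_eq_zero`,
binders = ★'s with `3 ↦ 2` minus the idle `hσ`, `h2`. [cite: HarishChandra1970, Part VII §2 Theorem 20 p. 70; §3 p. 71 eq. (1)] [cite: Rogawski1990, §4.9 p. 54] -/
theorem setIntegral_sdiff_heightBall_coeff_conj_eq_zero [SecondCountableTopology K] [SecondCountableTopology (GL (Fin 2) K)]
    [MeasurableSpace K] [BorelSpace K]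
    (σ : K →+* K) (hσc : Continuous σ) (hσv : ∀ x, Valued.v (σ x) = Valued.v x)
    {J : Matrix (Fin 2) (Fin 2) K} (hJ : J = (StdForm.antidiagonal 2).over K)
    [MeasurableSpace ↥(unitaryGroupOfForm σ J)] [BorelSpace ↥(unitaryGroupOfForm σ J)]
    [SecondCountableTopology ↥(unitaryGroupOfForm σ J)] [LocallyCompactSpace ↥(unitaryGroupOfForm σ J)]
    (μ : Measure ↥(unitaryGroupOfForm σ J)) [μ.IsHaarMeasure] [μ.IsMulRightInvariant]
    {ϖ : K} (hϖ : Valued.v ϖ = WithZero.exp (-1 : ℤ)) {ϖ' : K} (hϖ'0 : ϖ' ≠ 0) (hϖ'1 : valuation K ϖ' < 1) (hσϖ' : σ ϖ' = ϖ')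
    (hZs : ∀ z ∈ Subgroup.center ↥(unitaryGroupOfForm σ J), ∃ c : Kˣ,
      ((z : ↥(unitaryGroupOfForm σ J)) : GL (Fin 2) K) = Matrix.GeneralLinearGroup.scalar (Fin 2) c)
    (hZc : IsCompact ((Subgroup.center ↥(unitaryGroupOfForm σ J) : Subgroup ↥(unitaryGroupOfForm σ J)) : Set ↥(unitaryGroupOfForm σ J)))
    (Ω : CompactExhaustion ↥(unitaryGroupOfForm σ J))
    (hmem : ∀ (m : ℕ) (g : ↥(unitaryGroupOfForm σ J)), g ∈ Ω m ↔
      (∀ i j, Valued.v (ϖ ^ m * ((g : GL (Fin 2) K) : Matrix (Fin 2) (Fin 2) K) i j) ≤ 1) ∧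
        ∀ i j, Valued.v (ϖ ^ m * (((g : GL (Fin 2) K)⁻¹ : GL (Fin 2) K) : Matrix (Fin 2) (Fin 2) K) i j) ≤ 1)
    (hinv : ∀ (m : ℕ) (g : ↥(unitaryGroupOfForm σ J)), g ∈ Ω m → g⁻¹ ∈ Ω m)
    (hmul : ∀ (a b : ℕ) (g h : ↥(unitaryGroupOfForm σ J)), g ∈ Ω a → h ∈ Ω b → g * h ∈ Ω (a + b))
    {V : Type*} [AddCommGroup V] [Module ℂ V] (ρ : Representation ℂ ↥(unitaryGroupOfForm σ J) V) (hsm : ρ.IsSmooth) (hsc : ρ.IsSupercuspidal)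
    (B : V →ₗ⋆[ℂ] V →ₗ[ℂ] ℂ) (hBinv : ∀ (g : ↥(unitaryGroupOfForm σ J)) (x y : V), B (ρ g x) (ρ g y) = B x y) (u u' : V)
    (t : ↥(unitaryGroupOfForm σ J)) {d : Fin 2 → Kˣ} (hd : glDiagonal 2 K d = (t : GL (Fin 2) K)) (hreg : IsRegularElt (t : GL (Fin 2) K))
    (hsupp : ∃ C : Set ↥(unitaryGroupOfForm σ J), IsCompact C ∧ ∀ x : ↥(unitaryGroupOfForm σ J), B u' (ρ (x * t * x⁻¹) u) ≠ 0 →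
      x ∈ C * ((torusU σ J : Subgroup ↥(unitaryGroupOfForm σ J)) : Set ↥(unitaryGroupOfForm σ J)))
    (y : ↥(unitaryGroupOfForm σ J)) :
    ∃ R : ℕ, ∀ n : ℕ, ∫ x in Ω n \ Ω R, B u' (ρ (x * (y * t * y⁻¹) * x⁻¹) u) ∂μ = 0 :=
  K2E3SupercuspidalTruncatedCharThm20Two.setIntegral_sdiff_heightBall_coeff_conj_eq_zero σ hσc hJ μ hϖ'0 hϖ'1 hσϖ' hZs hZc Ω hmem hinv hmul
    (fun ν _ _ _ _ νbar _ _ _ _ _ _ hy f hf C _ hC hsupp' hcusp hcuspbar _ hx =>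
      K2E3CuspFormCancellationU2LevelOne.cuspForm_cancellation_levelOne_U2 σ hσc hσv hJ μ ν νbar hϖ Ω hmem hinv hmul hy f hf C hC hsupp' hcusp hcuspbar hx)
    ρ hsm hsc B hBinv u u' t hd hreg hsupp y

set_option synthInstance.maxHeartbeats 400000 in
set_option maxHeartbeats 1600000 in
-- instance-term unification on the model carriers (same class and value as the ★ `Fin 3` template)
/-- **THE TWO CONSUMER SHAPES AT A SPLIT-REGULAR `g = y t y⁻¹`, LETTER-FREE** (model side): with `Θₙ(g) := ∫_{Ω n} B u' (ρ(x g x⁻¹) u) dμ(x)`, ONE radius `R = R(g)` gives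
`Θₙ(g) = ∫_{Ω n ∩ Ω R} B u' (ρ(x g x⁻¹) u) dμ` for every `n` (the `hcanc` shape) AND `Θₙ(g) → Θ_R(g)` (the `hlim` shape) — ★ p861272 with `hT20 :=` ★
`cuspForm_cancellation_levelOne_U2`.  The `Fin 2` twin of ★ [M4] `exists_heightBall_truncatedCoeff_eq_inter_and_tendsto`, binders = ★'s with `3 ↦ 2` minus the idle `hσ`, `h2`.
[cite: HarishChandra1970, Part VII §3 p. 71 eq. (1), p. 72] -/
theorem exists_heightBall_truncatedCoeff_eq_inter_and_tendsto [SecondCountableTopology K] [SecondCountableTopology (GL (Fin 2) K)]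
    [MeasurableSpace K] [BorelSpace K]
    (σ : K →+* K) (hσc : Continuous σ) (hσv : ∀ x, Valued.v (σ x) = Valued.v x)
    {J : Matrix (Fin 2) (Fin 2) K} (hJ : J = (StdForm.antidiagonal 2).over K)
    [MeasurableSpace ↥(unitaryGroupOfForm σ J)] [BorelSpace ↥(unitaryGroupOfForm σ J)]
    [SecondCountableTopology ↥(unitaryGroupOfForm σ J)] [LocallyCompactSpace ↥(unitaryGroupOfForm σ J)]
    (μ : Measure ↥(unitaryGroupOfForm σ J)) [μ.IsHaarMeasure] [μ.IsMulRightInvariant]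
    {ϖ : K} (hϖ : Valued.v ϖ = WithZero.exp (-1 : ℤ)) {ϖ' : K} (hϖ'0 : ϖ' ≠ 0) (hϖ'1 : valuation K ϖ' < 1) (hσϖ' : σ ϖ' = ϖ')
    (hZs : ∀ z ∈ Subgroup.center ↥(unitaryGroupOfForm σ J), ∃ c : Kˣ,
      ((z : ↥(unitaryGroupOfForm σ J)) : GL (Fin 2) K) = Matrix.GeneralLinearGroup.scalar (Fin 2) c)
    (hZc : IsCompact ((Subgroup.center ↥(unitaryGroupOfForm σ J) : Subgroup ↥(unitaryGroupOfForm σ J)) : Set ↥(unitaryGroupOfForm σ J)))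
    (Ω : CompactExhaustion ↥(unitaryGroupOfForm σ J))
    (hmem : ∀ (m : ℕ) (g : ↥(unitaryGroupOfForm σ J)), g ∈ Ω m ↔
      (∀ i j, Valued.v (ϖ ^ m * ((g : GL (Fin 2) K) : Matrix (Fin 2) (Fin 2) K) i j) ≤ 1) ∧
        ∀ i j, Valued.v (ϖ ^ m * (((g : GL (Fin 2) K)⁻¹ : GL (Fin 2) K) : Matrix (Fin 2) (Fin 2) K) i j) ≤ 1)
    (hinv : ∀ (m : ℕ) (g : ↥(unitaryGroupOfForm σ J)), g ∈ Ω m → g⁻¹ ∈ Ω m)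
    (hmul : ∀ (a b : ℕ) (g h : ↥(unitaryGroupOfForm σ J)), g ∈ Ω a → h ∈ Ω b → g * h ∈ Ω (a + b))
    {V : Type*} [AddCommGroup V] [Module ℂ V] (ρ : Representation ℂ ↥(unitaryGroupOfForm σ J) V) (hsm : ρ.IsSmooth) (hsc : ρ.IsSupercuspidal)
    (B : V →ₗ⋆[ℂ] V →ₗ[ℂ] ℂ) (hBinv : ∀ (g : ↥(unitaryGroupOfForm σ J)) (x y : V), B (ρ g x) (ρ g y) = B x y) (u u' : V)
    (t : ↥(unitaryGroupOfForm σ J)) {d : Fin 2 → Kˣ} (hd : glDiagonal 2 K d = (t : GL (Fin 2) K)) (hreg : IsRegularElt (t : GL (Fin 2) K))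
    (hsupp : ∃ C : Set ↥(unitaryGroupOfForm σ J), IsCompact C ∧ ∀ x : ↥(unitaryGroupOfForm σ J), B u' (ρ (x * t * x⁻¹) u) ≠ 0 →
      x ∈ C * ((torusU σ J : Subgroup ↥(unitaryGroupOfForm σ J)) : Set ↥(unitaryGroupOfForm σ J)))
    (y : ↥(unitaryGroupOfForm σ J)) :
    ∃ R : ℕ, (∀ n : ℕ, ∫ x in Ω n, B u' (ρ (x * (y * t * y⁻¹) * x⁻¹) u) ∂μ = ∫ x in Ω n ∩ Ω R, B u' (ρ (x * (y * t * y⁻¹) * x⁻¹) u) ∂μ) ∧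
      Tendsto (fun n : ℕ => ∫ x in Ω n, B u' (ρ (x * (y * t * y⁻¹) * x⁻¹) u) ∂μ) atTop
        (𝓝 (∫ x in Ω R, B u' (ρ (x * (y * t * y⁻¹) * x⁻¹) u) ∂μ)) :=
  K2E3SupercuspidalTruncatedCharThm20Two.exists_heightBall_truncatedCoeff_eq_inter_and_tendsto σ hσc hJ μ hϖ'0 hϖ'1 hσϖ' hZs hZc Ω hmem hinv hmul
    (fun ν _ _ _ _ νbar _ _ _ _ _ _ hy f hf C _ hC hsupp' hcusp hcuspbar _ hx =>
      K2E3CuspFormCancellationU2LevelOne.cuspForm_cancellation_levelOne_U2 σ hσc hσv hJ μ ν νbar hϖ Ω hmem hinv hmul hy f hf C hC hsupp' hcusp hcuspbar hx)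
    ρ hsm hsc B hBinv u u' t hd hreg hsupp y

end Summit.HodgeConjecture.HodgeConjecture.Cruxes.H413.K2E3SupercuspidalTruncatedCharThm20TwoOfLevelOne

end
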